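/-
HONEST FRAMING: certified error envelopes and provably optimal rounding/accumulation schemes for
low-precision formats under stated cost models; every table by two implementations; no hardware
or vendor claims.
-/
import Summits.Ventures.CertifiedArithmetic.LowPrec.OptDemotionTreeWitness
import Summits.Ventures.CertifiedArithmetic.LowPrec.OptDemotionTiesFormats

/-!
# The demotion law (Theorem T8): `D_t ≥ Q_t` for every tree, realised by the formats' ties-to-even

`OptDemotionTreeWitness.demotion_tree_witness` gives, for every summation tree, nonnegative wide
floats whose demoted sum under-estimates by EXACTLY opt's `Q_t` — under three tie hypotheses on
the wide rounding and one on the narrow rounding.  `OptDemotionTiesFormats` shows that the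
Jeannerod–Rump model rounding `flJR` of every format of the venture (round-to-nearest-even,
gradual underflow, no overflow) has these properties.  THIS FILE combines the two: for every pair
of formats `α` (wide, `q = m_α + 1` bits) and `β` (narrow, `p = m_β + 1` bits) with `2 ≤ p`,
`p + 2 ≤ q`, and for EVERY tree `t` (root scale `2^e` above both underflow thresholds), the typed
witness of `t` evaluated with `α.flJR` and demoted with `β.flJR` satisfies `s = Q_t · fl_p(ŝ)`
(`demotion_tree_witness_flJR`).
E.g. binary16 accumulation demoted to bfloat16 (`q = 11`, `p = 8`), binary32 to binary16 or
bfloat16, binary32/binary16 to the FP8 formats: the lower-bound half of Conjecture D holds for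
ties-to-even arithmetic itself, for every tree shape.
-/

namespace Summit.Ventures.CertifiedArithmetic.LowPrec.Opt

open Literature.ComputerArithmetic.JeannerodRump2018
open Literature.ComputerArithmetic.JeannerodRump2018.SumTree
open Literature.ComputerArithmetic.FloatingPoint

/-- **`D_t ≥ Q_t` FOR EVERY TREE, IN THE FORMATS.**  Wide format `α` (`q = m_α + 1`), narrow
format `β` (`p = m_β + 1`, `2 ≤ p`, `p + 2 ≤ q`), both rounding to nearest even (`flJR`): for
every tree `t` and every `e ≥ qexp α + q·(height t + 1)` with `e ≥ qexp β`, the typed witness of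
`t` is a tree of nonnegative floats of `F(q, qexp α)` that the wide format sums to `2^e(1+u_p)`,
the narrow format demotes to `2^e`, and whose exact sum is `Q_t · 2^e`:
`s = Q_t · fl_β(fl_α-sum)`. -/
theorem demotion_tree_witness_flJR (α β : Format) (hp : 2 ≤ β.manBits + 1)
    (hpq : β.manBits + 1 + 2 ≤ α.manBits + 1) (t : SumTree) {e : ℤ} (heβ : β.qexp ≤ e)
    (he : α.qexp + ((α.manBits + 1 : ℕ) : ℤ) * ((height t : ℤ) + 1) ≤ e) :
    (∀ x ∈ leaves (witD (β.manBits + 1) (α.manBits + 1) (unitRoundoff (α.manBits + 1))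
        (unitRoundoff (β.manBits + 1)) (unitRoundoff (α.manBits + 1 - (β.manBits + 1))) t .Q e),
        IsFloat (α.manBits + 1) α.qexp x ∧ 0 ≤ x) ∧
    eval α.flJR (witD (β.manBits + 1) (α.manBits + 1) (unitRoundoff (α.manBits + 1))
        (unitRoundoff (β.manBits + 1)) (unitRoundoff (α.manBits + 1 - (β.manBits + 1))) t .Q e)
      = (2 : ℚ) ^ e + (2 : ℚ) ^ e * unitRoundoff (β.manBits + 1) ∧
    β.flJR ((2 : ℚ) ^ e + (2 : ℚ) ^ e * unitRoundoff (β.manBits + 1)) = (2 : ℚ) ^ e ∧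
    exact (witD (β.manBits + 1) (α.manBits + 1) (unitRoundoff (α.manBits + 1))
        (unitRoundoff (β.manBits + 1)) (unitRoundoff (α.manBits + 1 - (β.manBits + 1))) t .Q e)
      = treeQf (unitRoundoff (α.manBits + 1)) t (unitRoundoff (β.manBits + 1)) * (2 : ℚ) ^ e := by
  obtain ⟨hQ, hR, hM⟩ := demotion_ties_flJR α hp hpq
  obtain ⟨l, ev, ex⟩ := witD_spec (by omega) (by omega) hM hQ hR t .Q e he
  have hdem : β.flJR ((2 : ℚ) ^ e + (2 : ℚ) ^ e * unitRoundoff (β.manBits + 1)) = (2 : ℚ) ^ e :=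
    Format.flJR_midpoint_pow (φ := β) (by omega) heβ
  simp only [dval] at ev
  refine ⟨l, ev, hdem, ?_⟩
  rw [ex]; simp only [dpoly]; ring

/-- The parameter hypotheses for the venture's standard demotion pairs (narrow `p ≥ 2`,
`p + 2 ≤ q`): binary16 → bfloat16 (`q = 11`, `p = 8`), binary32 → binary16 (`24`, `11`),
binary32 → bfloat16 (`24`, `8`), binary16 → E5M2 (`11`, `3`), binary16 → E4M3 (`11`, `4`),
binary32 → E4M3 (`24`, `4`). -/
theorem demotion_pairs_parameters :
    (2 ≤ Format.BFloat16.manBits + 1 ∧ Format.BFloat16.manBits + 1 + 2 ≤ Format.Binary16.manBits + 1) ∧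
    (2 ≤ Format.Binary16.manBits + 1 ∧ Format.Binary16.manBits + 1 + 2 ≤ Format.Binary32.manBits + 1) ∧
    (2 ≤ Format.BFloat16.manBits + 1 ∧ Format.BFloat16.manBits + 1 + 2 ≤ Format.Binary32.manBits + 1) ∧
    (2 ≤ Format.E5M2.manBits + 1 ∧ Format.E5M2.manBits + 1 + 2 ≤ Format.Binary16.manBits + 1) ∧
    (2 ≤ Format.E4M3.manBits + 1 ∧ Format.E4M3.manBits + 1 + 2 ≤ Format.Binary16.manBits + 1) ∧
    (2 ≤ Format.E4M3.manBits + 1 ∧ Format.E4M3.manBits + 1 + 2 ≤ Format.Binary32.manBits + 1) := by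
  refine ⟨⟨by decide, by decide⟩, ⟨by decide, by decide⟩, ⟨by decide, by decide⟩, ⟨by decide, by decide⟩,
    ⟨by decide, by decide⟩, ⟨by decide, by decide⟩⟩

/-! ## Ledger-facing statement -/

/-- R4/T8 (OPTIMA.md §B T8(b)(ii) — `D_t ≥ Q_t` for every tree): for all precisions `1 ≤ p`,
`p + 1 ≤ q`, every `emin`, every wide rounding `fl_q` resolving the binade ties and the two kinds
of shifted ties downwards (as roundTiesToEven does for `2 ≤ p`, `p + 2 ≤ q`: `demotion_ties_flJR`)
and every narrow rounding `fl_p` with ties-to-even at the binade points, and for EVERY summation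
tree `t`: there are nonnegative floats of `F(q, emin)` on the shape of `t` (the typed witness at any
scale `2^e`, `e ≥ emin + q(height t + 1)`) whose demoted computed sum `r` satisfies
`s = Q_t · r` exactly, `Q_t = treeQf u_q t u_p` (opt's coupled tree polynomial). -/
def R4_DemotionWitnessEveryTree : Prop :=
  ∀ (p q : ℕ), 1 ≤ p → p + 1 ≤ q → ∀ (emin : ℤ) (flq flp : ℚ → ℚ),
    TiesEvenAtPow q emin flq → TiesDownAtShift p q emin flq → TiesDownAtShift (q - p) q emin flq →
    TiesEvenAtPow p emin flp → ∀ (t : SumTree) (e : ℤ), emin + (q : ℤ) * ((height t : ℤ) + 1) ≤ e →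
      (∀ x ∈ leaves (witD p q (unitRoundoff q) (unitRoundoff p) (unitRoundoff (q - p)) t .Q e),
          IsFloat q emin x ∧ 0 ≤ x) ∧
      exact (witD p q (unitRoundoff q) (unitRoundoff p) (unitRoundoff (q - p)) t .Q e)
        = treeQf (unitRoundoff q) t (unitRoundoff p)
          * flp (eval flq (witD p q (unitRoundoff q) (unitRoundoff p) (unitRoundoff (q - p)) t .Q e))

/-- `R4_DemotionWitnessEveryTree` holds. -/
theorem R4_DemotionWitnessEveryTree_holds : R4_DemotionWitnessEveryTree := by
  intro p q hp hpq emin flq flp hM hQ hR hE t e he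
  obtain ⟨l, -, -, ex⟩ := demotion_tree_witness hp hpq hM hQ hR hE t he
  exact ⟨l, ex⟩

end Summit.Ventures.CertifiedArithmetic.LowPrec.Opt
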